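import Literature.AlgebraicGeometry.Frobenioids.ArithmeticFrobenioidThm64iiiDegreeForm
import HarnessLib

/-!
# Frobenioids I, Theorem 6.4 (iii) for an arbitrary `Ψ′` — the degree reading `hdeg` from Thm. 6.4 (ii)'s class-map
# clause and the transport compatibility through the square (row «T64iii-ARBITRARY-Ψ′», piece (G3), knit adapter)

Mochizuki, *The geometry of Frobenioids I: the general theory*, Kyushu J. Math. **62** (2008) 293–400, §6,
Thm. 6.4 (iii), proof p. 116 l. 4–16 ("(ii) applied to the generator class"); (ii) p. 114 ("the isomorphism
`Pic_Φ(A₁) ⥲ Pic_Φ(A₂)` induced by `Ψ^rlf`"). [cite: MochizukiFrdI2008, Thm. 6.4 (iii) p.116]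

PROOF-ONLY file (cell abc-iut, seat abc-iut-L1-d9; L1-lead R129 (1) piece (G3), sequel to
`ArithmeticFrobenioidThm64iiiDegreeForm.lean`; assembler abc-iut-L1-t3; 0 `def`).  The one hypothesis `hdeg` of
`thm64iii_arith_of_degreeReading` — "`δ_{Ψrlf (L₁,0)}(picMap [ι₁ x]) = d_{L₂}(ι₂ (θ x))`" — is DERIVED here from the two
shapes its producers deliver, so the knit is by name:
* the CLASS-MAP CLAUSE of [FrdI] Thm. 6.4 (ii) at THE data for the (arbitrary) equivalence `Ψrlf` — abc-iut-L6-t10's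
  `ArithFrd.thm64ii_arith'` (p433994), conjunct "`δ_{Ψ A}(picMap_A [x]) = picDegree_{Ψ^Base(Base A)} [E x]`" — taken as
  the binder `hpic` at `A = (L₁, 0)` with ANY target base object `Y` and ANY map `e : Φ^rlf(L₁) → Φ^rlf(L_Y)` (there:
  `Y = Ψ^Base L₁`, `e = E.iso L₁`);
* the TRANSPORT COMPATIBILITY through the square `Ψ′ ⋙ u₂ ≅ u₁ ⋙ Ψrlf` (piece (G2), abc-iut-L1-d2, shape of
  abc-iut-L1-t3's `T64iii-ARBITRARY-SHAPES.md`): "`ι₂ (θ m) = Φ^rlf(γ) (e (ι₁ m))`" for a base ISOMORPHISM `γ : L₂ ≅ Y` —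
  the binder `hG2`;
using THE degree's invariance under `Φ^rlf(γ)` for an iso (`ArithRlfPic.rlfDegree_rlfMap_of_iso`) and
`δ [a] = d(a)` (abc-iut-L1-d2's `ArithRlfPic.arith_picDegree_mk_of`).  Result: `degreeReading_of_classClause_of_transportCompat`
and the knit-ready `exists_placeMap_thm64iii_arith_of_classClause` (`∃ placeMap, prime-compatible ∧ ∀ deg, Thm64iii …`).
Nothing here bears on [IUTchIII] Cor. 3.12; no statement of the paper is strengthened.
-/

noncomputable section

open scoped NNReal

namespace Literature.AlgebraicGeometry.Frobenioids

open CategoryTheory Opposite Function NumberField EffArithDivisor Literature.AnabelianGeometry.EtaleTheta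

section DegreeReading

variable {F₁ : Type} [Field F₁] [NumberField F₁] {K₁ : Type} [Field K₁] [Algebra F₁ K₁]
  {F₂ : Type} [Field F₂] [NumberField F₂] {K₂ : Type} [Field K₂] [Algebra F₂ K₂]
  (hΦ₁ : PreFrobenioid.IsPerfFactorialOn (arithDivisorFunctor F₁ K₁))
  (hΦ₂ : PreFrobenioid.IsPerfFactorialOn (arithDivisorFunctor F₂ K₂))
  (Ψrlf : PreFrobenioid.rlf (ModelFrobenioid.toElem (arithDivisorFunctor F₁ K₁) (unitsFunctor F₁ K₁)
      (divNatTrans F₁ K₁)) hΦ₁ ≌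
    PreFrobenioid.rlf (ModelFrobenioid.toElem (arithDivisorFunctor F₂ K₂) (unitsFunctor F₂ K₂)
      (divNatTrans F₂ K₂)) hΦ₂)
  (picMap : ∀ A, (arithRealification hΦ₁).Pic A ≃+ (arithRealification hΦ₂).Pic (Ψrlf.functor.obj A))
  {U₁ : Type} [Category.{0} U₁] {U₂ : Type} [Category.{0} U₂]
  (u₁ : U₁ ⥤ PreFrobenioid.rlf (ModelFrobenioid.toElem (arithDivisorFunctor F₁ K₁) (unitsFunctor F₁ K₁)
    (divNatTrans F₁ K₁)) hΦ₁)
  (u₂ : U₂ ⥤ PreFrobenioid.rlf (ModelFrobenioid.toElem (arithDivisorFunctor F₂ K₂) (unitsFunctor F₂ K₂)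
    (divNatTrans F₂ K₂)) hΦ₂)
  (Ψ' : U₁ ≌ U₂) (A₁ : U₁)
  (θ : Perfection (Multiplicative (EffArithDivisor ((arithRealification hΦ₁).ops.base.obj (u₁.obj A₁)).L)) ≃*
    Perfection (Multiplicative (EffArithDivisor
      ((arithRealification hΦ₂).ops.base.obj (u₂.obj (Ψ'.functor.obj A₁))).L)))
  (hA' : (arithRealification hΦ₂).ops.IsFrobeniusTrivial
    (Ψrlf.functor.obj ⟨(arithRealification hΦ₁).ops.base.obj (u₁.obj A₁), 1⟩))
  -- the target base object of the transport of `Ψrlf` at `L₁` and a base iso from `L₂`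
  (Y : FinSubextCat F₂ K₂) (γ : (arithRealification hΦ₂).ops.base.obj (u₂.obj (Ψ'.functor.obj A₁)) ≅ Y)
  -- the realified transport of `Ψrlf` at `L₁` (any function; `E.iso L₁` of `thm64ii_arith'`)
  (e : (PreFrobenioid.IsPerfFactorialOn.op hΦ₁ (op ((arithRealification hΦ₁).ops.base.obj (u₁.obj A₁)))).Rlf →
    (PreFrobenioid.IsPerfFactorialOn.op hΦ₂ (op Y)).Rlf)
  -- Thm. 6.4 (ii)'s class-map clause at `A = (L₁, 0)` (abc-iut-L6-t10's `thm64ii_arith'`, penultimate-but-one conjunct)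
  (hpic : ∀ x : (PreFrobenioid.IsPerfFactorialOn.op hΦ₁ (op ((arithRealification hΦ₁).ops.base.obj (u₁.obj A₁)))).Rlf,
    (arithRealification hΦ₂).δ _ hA'
        (picMap ⟨(arithRealification hΦ₁).ops.base.obj (u₁.obj A₁), 1⟩
          (Additive.ofMul (QuotientGroup.mk' _ (Algebra.GrothendieckGroup.of x)))) =
      Multiplicative.toAdd (ArithRlfPic.picDegree hΦ₂ Y
        (QuotientGroup.mk' _ (Algebra.GrothendieckGroup.of (e x)))))
  -- the transport compatibility through the square (piece (G2), abc-iut-L1-d2)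
  (hG2 : ∀ m : Perfection (Multiplicative (EffArithDivisor ((arithRealification hΦ₁).ops.base.obj (u₁.obj A₁)).L)),
    (PreFrobenioid.IsPerfFactorialOn.op hΦ₂ (op ((arithRealification hΦ₂).ops.base.obj
        (u₂.obj (Ψ'.functor.obj A₁))))).toRealification (θ m) =
      rlfMap (arithDivisorFunctor F₂ K₂) (PreFrobenioid.IsPerfFactorialOn.op hΦ₂) γ.hom.op
        (e ((PreFrobenioid.IsPerfFactorialOn.op hΦ₁ (op ((arithRealification hΦ₁).ops.base.obj
          (u₁.obj A₁)))).toRealification m)))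

include hpic hG2 in
/-- **The degree reading `hdeg` from the class-map clause and the transport compatibility.**
`δ_{Ψrlf (L₁,0)}(picMap [ι₁ x]) = picDegree_Y [e (ι₁ x)] = d_Y(e (ι₁ x)) = d_{L₂}(Φ^rlf(γ)(e (ι₁ x))) = d_{L₂}(ι₂ (θ x))`
(`δ[a] = d(a)`; THE degree is invariant under the pull-back along the base iso `γ`; (G2)).
[cite: MochizukiFrdI2008, Thm. 6.4 (iii) p.116] -/
theorem degreeReading_of_classClause_of_transportCompat
    (x : Perfection (Multiplicative (EffArithDivisor ((arithRealification hΦ₁).ops.base.obj (u₁.obj A₁)).L))) :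
    (arithRealification hΦ₂).δ _ hA'
        (picMap ⟨(arithRealification hΦ₁).ops.base.obj (u₁.obj A₁), 1⟩
          (Additive.ofMul (QuotientGroup.mk' _ (Algebra.GrothendieckGroup.of
            ((PreFrobenioid.IsPerfFactorialOn.op hΦ₁ (op ((arithRealification hΦ₁).ops.base.obj
              (u₁.obj A₁)))).toRealification x))))) =
      ((Multiplicative.toAdd (ArithRlfPic.rlfDegree hΦ₂
          ((arithRealification hΦ₂).ops.base.obj (u₂.obj (Ψ'.functor.obj A₁)))
          ((PreFrobenioid.IsPerfFactorialOn.op hΦ₂ (op ((arithRealification hΦ₂).ops.base.obj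
            (u₂.obj (Ψ'.functor.obj A₁))))).toRealification (θ x))) : ℝ≥0) : ℝ) := by
  -- `picDegree_Y [e a] = d_Y (e a)` read in `ℝ`
  have h1 := ArithRlfPic.arith_picDegree_mk_of hΦ₂ Y (ArithRlfPic.rlfDegree hΦ₂ Y) (ArithRlfPic.picDegree hΦ₂ Y)
    (ArithRlfPic.picDegree_comp_mk' hΦ₂ Y)
    (e ((PreFrobenioid.IsPerfFactorialOn.op hΦ₁ (op ((arithRealification hΦ₁).ops.base.obj
      (u₁.obj A₁)))).toRealification x))
  -- `d_{L₂}(Φ^rlf(γ) b) = d_Y b`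
  have h2 := ArithRlfPic.rlfDegree_rlfMap_of_iso hΦ₂ γ
    (e ((PreFrobenioid.IsPerfFactorialOn.op hΦ₁ (op ((arithRealification hΦ₁).ops.base.obj
      (u₁.obj A₁)))).toRealification x))
  refine (hpic _).trans ?_
  refine (congrArg Multiplicative.toAdd h1).trans ?_
  rw [toAdd_ofAdd, ← h2, ← hG2]

include hpic hG2 in
/-- **[FrdI] Theorem 6.4 (iii) AS TYPED, AT THE DATA, for an arbitrary `Ψ′` — knit-ready form.**  From the perfected
divisor transport `θ` of `Ψ′` at `A₁` (abc-iut-L1-d1), the Frobenius-triviality of `Ψrlf (L₁,0)`, Thm. 6.4 (ii)'s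
class-map clause for `Ψrlf` (abc-iut-L6-t10) and the transport compatibility through the square (abc-iut-L1-d2):
THE bijection of places of `θ` and, for EVERY `deg`, the schema `Thm64iii R₁ R₂ Ψrlf picMap deg u₁ u₂ Ψ′ A₁ placeMap`.
[cite: MochizukiFrdI2008, Thm. 6.4 (iii) p.116] -/
theorem exists_placeMap_thm64iii_arith_of_classClause :
    ∃ placeMap : Places ((arithRealification hΦ₁).ops.base.obj (u₁.obj A₁)).L ≃
        Places ((arithRealification hΦ₂).ops.base.obj (u₂.obj (Ψ'.functor.obj A₁))).L,
      (∀ v, Primes.congr θ (Quotient.mk (primarySetoid _) ⟨_, EffArithDivisor.isPrimary_of_single _ v⟩) =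
        Quotient.mk (primarySetoid _) ⟨_, EffArithDivisor.isPrimary_of_single _ (placeMap v)⟩) ∧
      ∀ deg : ℝ, Thm64iii (arithRealification hΦ₁) (arithRealification hΦ₂) Ψrlf picMap deg u₁ u₂ Ψ' A₁ placeMap :=
  exists_placeMap_thm64iii_arith_of_degreeReading hΦ₁ hΦ₂ Ψrlf picMap u₁ u₂ Ψ' A₁ θ hA'
    (degreeReading_of_classClause_of_transportCompat hΦ₁ hΦ₂ Ψrlf picMap u₁ u₂ Ψ' A₁ θ hA' Y γ e hpic hG2)

/-! ### The same with (G2) phrased through the operations' pull-back `(arithRealification hΦ₂).ops.pull γ.hom`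
(abc-iut-L1-t3's letter 09:54Z; definitionally the `rlfMap` form) -/

include hpic in
/-- `degreeReading_of_classClause_of_transportCompat` with (G2) in the form
`ι₂ (θ m) = (arithRealification hΦ₂).ops.pull γ.hom (e (ι₁ m))`. [cite: MochizukiFrdI2008, Thm. 6.4 (iii) p.116] -/
theorem degreeReading_of_classClause_of_transportCompat'
    (hG2' : ∀ m : Perfection (Multiplicative (EffArithDivisor ((arithRealification hΦ₁).ops.base.obj (u₁.obj A₁)).L)),
      (PreFrobenioid.IsPerfFactorialOn.op hΦ₂ (op ((arithRealification hΦ₂).ops.base.obj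
          (u₂.obj (Ψ'.functor.obj A₁))))).toRealification (θ m) =
        (arithRealification hΦ₂).ops.pull γ.hom
          (e ((PreFrobenioid.IsPerfFactorialOn.op hΦ₁ (op ((arithRealification hΦ₁).ops.base.obj
            (u₁.obj A₁)))).toRealification m)))
    (x : Perfection (Multiplicative (EffArithDivisor ((arithRealification hΦ₁).ops.base.obj (u₁.obj A₁)).L))) :
    (arithRealification hΦ₂).δ _ hA'
        (picMap ⟨(arithRealification hΦ₁).ops.base.obj (u₁.obj A₁), 1⟩
          (Additive.ofMul (QuotientGroup.mk' _ (Algebra.GrothendieckGroup.of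
            ((PreFrobenioid.IsPerfFactorialOn.op hΦ₁ (op ((arithRealification hΦ₁).ops.base.obj
              (u₁.obj A₁)))).toRealification x))))) =
      ((Multiplicative.toAdd (ArithRlfPic.rlfDegree hΦ₂
          ((arithRealification hΦ₂).ops.base.obj (u₂.obj (Ψ'.functor.obj A₁)))
          ((PreFrobenioid.IsPerfFactorialOn.op hΦ₂ (op ((arithRealification hΦ₂).ops.base.obj
            (u₂.obj (Ψ'.functor.obj A₁))))).toRealification (θ x))) : ℝ≥0) : ℝ) :=
  degreeReading_of_classClause_of_transportCompat hΦ₁ hΦ₂ Ψrlf picMap u₁ u₂ Ψ' A₁ θ hA' Y γ e hpic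
    (fun m => (hG2' m).trans rfl) x

include hpic in
/-- `exists_placeMap_thm64iii_arith_of_classClause` with (G2) in the `ops.pull` form.
[cite: MochizukiFrdI2008, Thm. 6.4 (iii) p.116] -/
theorem exists_placeMap_thm64iii_arith_of_classClause'
    (hG2' : ∀ m : Perfection (Multiplicative (EffArithDivisor ((arithRealification hΦ₁).ops.base.obj (u₁.obj A₁)).L)),
      (PreFrobenioid.IsPerfFactorialOn.op hΦ₂ (op ((arithRealification hΦ₂).ops.base.obj
          (u₂.obj (Ψ'.functor.obj A₁))))).toRealification (θ m) =
        (arithRealification hΦ₂).ops.pull γ.hom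
          (e ((PreFrobenioid.IsPerfFactorialOn.op hΦ₁ (op ((arithRealification hΦ₁).ops.base.obj
            (u₁.obj A₁)))).toRealification m))) :
    ∃ placeMap : Places ((arithRealification hΦ₁).ops.base.obj (u₁.obj A₁)).L ≃
        Places ((arithRealification hΦ₂).ops.base.obj (u₂.obj (Ψ'.functor.obj A₁))).L,
      (∀ v, Primes.congr θ (Quotient.mk (primarySetoid _) ⟨_, EffArithDivisor.isPrimary_of_single _ v⟩) =
        Quotient.mk (primarySetoid _) ⟨_, EffArithDivisor.isPrimary_of_single _ (placeMap v)⟩) ∧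
      ∀ deg : ℝ, Thm64iii (arithRealification hΦ₁) (arithRealification hΦ₂) Ψrlf picMap deg u₁ u₂ Ψ' A₁ placeMap :=
  exists_placeMap_thm64iii_arith_of_classClause hΦ₁ hΦ₂ Ψrlf picMap u₁ u₂ Ψ' A₁ θ hA' Y γ e hpic
    (fun m => (hG2' m).trans rfl)

end DegreeReading

end Literature.AlgebraicGeometry.Frobenioids

end
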